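import Summits.AtomisticToContinuum.HydrodynamicLimit.Theses.SuperextensiveClosureCost
import Literature.Analysis.FluidPDE.HardSphereAlexander

/-!
# Strategist sketch r1 — crux `MomentumClosureCost` (stmt-AtomisticToContinuum-14424)

Kernel companion of `Cruxes/MomentumClosureCost/STRATEGY-CENSUS.md` (crux-strategist r1,
planner-cstrat-stmt-AtomisticToContinuum-14424-r1-0, 2026-08-17).  NOT a skeleton (no `stub_*`,
nothing registered).  Contents:

* §S  `MomentumClosureCostQuartic` — the refuter's repaired statement C′ (SUSPECT-FALSE-14424.md §9:
  the fourth-moment cap `Σ_i ‖v_i(r)‖⁴ ≤ K (N+1)` added to the conditioning event, `∀ K > 0`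
  quantified with `θe`), typed verbatim from the route decl so that a tenure planner can file it with
  one `ledger workitem add … --signature`.  `quartic_of_momentumClosureCost : C → C′` (monotonicity of
  the measure) certifies that the repair is a WEAKENING of the crux: no line for the crux as typed can
  pass through C′, and C′ is a different item (restatement), outside a strategist's remit.
* §D  the abstract accumulation lemma behind decomposition candidate D2 (kinetic window → macroscopic
  window): a superexponential bound for the frequency of bad windows follows from a CONDITIONAL
  per-window bound given the past — the hypothesis no deterministic argument supplies.  Stated and
  proved for a finite family of events under a uniform conditional bound (product form), to fix the
  shape of the missing input; it is bookkeeping, not a stub.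
* §N  `NeedleDefectFloor` — the refuter's O(N) witness TYPED as a linear-cost floor for the crux's own
  event (hot-tenuous variant of CornersLogPrice's `CornerDefectFloor`, stmt-12329), and the kernel-checked
  `not_momentumClosureCost_of_needleDefectFloor : NeedleDefectFloor → ¬ MomentumClosureCost` — the exact
  target a cdisprove seat must land to close the item `refuted`.
-/

namespace Summit.AtomisticToContinuum.HydrodynamicLimit.Cruxes.MomentumClosureCost.StrategistR1

open scoped BigOperators Topology Classical MeasureTheory ENNReal
open Filter Set Function MeasureTheory
open Summit.AtomisticToContinuum.HydrodynamicLimit.Theses.SuperextensiveClosureCost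

/-! ## §S  The repaired statement C′ (fourth-moment cap) and `C → C′` -/

/-- **C′ = `MomentumClosureCost` with the fourth-moment cap** `Σ_i ‖v_i(r)‖⁴ ≤ K·(N+1)` on the whole
window added to the conditioning event (third conjunct), `∀ K > 0` quantified right after `θe`
(refuter rreview1, SUSPECT-FALSE-14424.md §9; the vacuum-gap needle-beam witness has
`Σ‖v‖⁴/(N+1) ≍ (3/4)·U² = (3/16)(N+1)^(1/12) → ∞` and misses it).  Everything else verbatim. -/
def MomentumClosureCostQuartic : Prop :=
  ∃ η₁ : ℝ, 0 < η₁ ∧ ∃ σ₀ : ℝ, 0 < σ₀ ∧ ∀ σ : ℝ, 0 < σ → σ < σ₀ → ∀ θe : ℝ, 0 < θe → ∀ K : ℝ, 0 < K → ∀ Φ : (N : ℕ) → Literature.Analysis.FluidPDE.HardSphereFlow (Literature.Analysis.FluidPDE.Torus.geometry (Fin 3)) (Literature.MathematicalPhysics.KineticTheory.hsDiameter σ N) (N + 1), ∀ (s τ : ℝ), 0 ≤ s → 0 < τ → ∀ ψ : ℝ → Literature.MathematicalPhysics.KineticTheory.T3 → Literature.MathematicalPhysics.KineticTheory.V3, Literature.Analysis.FunctionSpaces.Torus.IsSmoothSpaceTimeOn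 (Set.Icc s (s + τ)) ψ → ∀ δ : ℝ, 0 < δ → ∀ M : ℝ, ∀ᶠ N : ℕ in Filter.atTop, Literature.MathematicalPhysics.KineticTheory.localGibbsLaw σ (fun _ => 1) (fun _ => 0) (fun _ => θe) N (Φ N) {z | let ℓ : ℝ := ((N + 1 : ℕ) : ℝ) ^ (-(1 / 4 : ℝ)); let χ : Literature.MathematicalPhysics.KineticTheory.T3 → Literature.MathematicalPhysics.KineticTheory.T3 → ℝ := fun x y => if Literature.Analysis.FluidPDE.Torus.euclidDist x y < ℓ then (4 / 3 * Real.pi * ℓ ^ 3)⁻¹ else 0; let ρ : ℝ → Literature.MathematicalPhysics.KineticTheory.T3 → ℝ := fun r x => Literature.MathematicalPhysics.KineticTheory.empiricalDensityField ((Φ N).flow r z) (χ x); let m : ℝ → Literature.MathematicalPhysics.KineticTheory.T3 → Literature.MathematicalPhysics.KineticTheory.V3 := fun r x => Literature.MathematicalPhysics.KineticTheory.empiricalMomentumField ((Φ N).flow r z) (χ x); let e : ℝ → Literature.MathematicalPhysics.KineticTheory.T3 → ℝ := fun r x => Literature.MathematicalPhysics.KineticTheory.empiricalEnergyField ((Φ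 N).flow r z) (χ x); let p : ℝ → Literature.MathematicalPhysics.KineticTheory.T3 → ℝ := fun r x => Literature.MathematicalPhysics.KineticTheory.hsPressure σ (ρ r x) (2 / 3 * (e r x / ρ r x - ‖m r x‖ ^ 2 / (2 * ρ r x ^ 2))); let Mt : ℝ → (Literature.MathematicalPhysics.KineticTheory.T3 → Literature.MathematicalPhysics.KineticTheory.V3) → ℝ := fun r g => ∑ j, (Literature.MathematicalPhysics.KineticTheory.empiricalMomentumField ((Φ N).flow r z) (fun y => g y j)) j; (∀ r ∈ Set.Icc s (s + τ), ∀ i, ‖((Φ N).flow r z i).2‖ ≤ ((N + 1 : ℕ) : ℝ) ^ (1 / 24 : ℝ)) ∧ (∀ r ∈ Set.Icc s (s + τ), ∀ x, ρ r x * σ ^ 3 ≤ η₁) ∧ (∀ r ∈ Set.Icc s (s + τ), (∑ i, ‖((Φ N).flow r z i).2‖ ^ 4) ≤ K * ((N + 1 : ℕ) : ℝ)) ∧ δ < |Mt (s + τ) (ψ (s + τ)) - Mt s (ψ s) - ∫ r in s..(s + τ), (Mt r (Literature.Analysis.FunctionSpaces.Torus.timeDerivWithin (Set.Icc s (s + τ))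 ψ r) + ∫ x, ((∑ i, ∑ j, (Literature.Analysis.FunctionSpaces.Torus.partialDeriv i (ψ r) x) j * (m r x i * m r x j / ρ r x)) + p r x * Literature.Analysis.FunctionSpaces.Torus.divergence (ψ r) x))|} ≤ ENNReal.ofReal (Real.exp (-(M * (N + 1))))

/-- The repair is a weakening: the crux as typed implies C′ (the capped event shrinks).  Hence C′
cannot be a stub of a line concluding the crux, and filing C′ is a restatement (tenure). -/
theorem quartic_of_momentumClosureCost (h : MomentumClosureCost) : MomentumClosureCostQuartic := by
  obtain ⟨η₁, hη₁, σ₀, hσ₀, H⟩ := h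
  refine ⟨η₁, hη₁, σ₀, hσ₀, ?_⟩
  intro σ hσ hσ' θe hθe K _hK Φ s τ hs hτ ψ hψ δ hδ M
  filter_upwards [H σ hσ hσ' θe hθe Φ s τ hs hτ ψ hψ δ hδ M] with N hN
  refine le_trans (measure_mono ?_) hN
  intro z hz
  simp only [Set.mem_setOf_eq] at hz ⊢
  exact ⟨hz.1, hz.2.1, hz.2.2.2⟩

/-! ## §D  The accumulation lemma (shape of the missing input of candidate D2) -/

/-- Abstract accumulation: if each of `n` "windows" is bad with CONDITIONAL probability at most `p`
given the badness pattern of the earlier windows (here in the strong product form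
`μ (⋂ k ∈ S, B k) ≤ p ^ S.card` for every set `S` of windows), then all `n` windows are bad with
probability `≤ p ^ n` — superexponential in the particle number as soon as `n = n_N → ∞` and
`p = e^{-cN}`.  For the deterministic hard-sphere flow under the invariant law NO such conditional
bound is known for any block observable: this hypothesis is the decorrelation content of the crux. -/
theorem accumulate_of_conditional {Ω : Type*} [MeasurableSpace Ω] (μ : Measure Ω) {n : ℕ}
    (B : Fin n → Set Ω) (p : ℝ≥0∞)
    (hcond : ∀ S : Finset (Fin n), μ (⋂ k ∈ S, B k) ≤ p ^ S.card) :
    μ (⋂ k, B k) ≤ p ^ n := by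
  have := hcond Finset.univ
  simpa using this


/-! ## §N  The negation typed: an O(N)-cost defect floor refutes the crux -/

open Literature.Analysis.FluidPDE Literature.MathematicalPhysics.KineticTheory in
/-- **`NeedleDefectFloor`** — the refuter's vacuum-gap needle-beam witness (SUSPECT-FALSE-14424.md)
as a statement: for every packing level `η₁ > 0`, for all small `σ` and every flow family there are
a temperature `θe`, a window `[0, τ]`, a smooth test field `ψ`, a tolerance `δ > 0` and a LINEAR
rate `c` such that, for infinitely many `N`, the crux's own event (speed cap ∧ ball-packing cap
`≤ η₁` ∧ `|D_N| > δ`, verbatim with `s := 0`) has `G_N`-probability `> e^{-c(N+1)}`.  It is the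
hot-tenuous (`f_N = 3(N+1)^{-1/12}` heads at speed `(N+1)^{1/24}/2`) variant, inside an evacuated
slab, of route CornersLogPrice's typed support `CornerDefectFloor` (stmt-12329, rate
`e^{-(1+κ)(N+1)log(N+1)}`, thermal corners): only the o(N) minority pays the `log(N+1)` aiming
price, the slab costs `0.80(N+1)`, the beams' kinetic energy `1.5(N+1)` at `θe = 1/4`. -/
def NeedleDefectFloor : Prop :=
  ∀ η₁ : ℝ, 0 < η₁ → ∃ σ₁ : ℝ, 0 < σ₁ ∧ ∀ σ : ℝ, 0 < σ → σ < σ₁ → ∀ Φ : (N : ℕ) → Literature.Analysis.FluidPDE.HardSphereFlow (Literature.Analysis.FluidPDE.Torus.geometry (Fin 3)) (Literature.MathematicalPhysics.KineticTheory.hsDiameter σ N) (N + 1), ∃ θe : ℝ, 0 < θe ∧ ∃ τ : ℝ, 0 < τ ∧ ∃ ψ : ℝ → Literature.MathematicalPhysics.KineticTheory.T3 → Literature.MathematicalPhysics.KineticTheory.V3, Literature.Analysis.FunctionSpaces.Torus.IsSmoothSpaceTimeOn (Set.Icc 0 (0 + τ)) ψ ∧ ∃ δ : ℝ, 0 < δ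 ∧ ∃ c : ℝ, ∃ᶠ N : ℕ in Filter.atTop, ENNReal.ofReal (Real.exp (-(c * (N + 1)))) < Literature.MathematicalPhysics.KineticTheory.localGibbsLaw σ (fun _ => 1) (fun _ => 0) (fun _ => θe) N (Φ N) {z | let ℓ : ℝ := ((N + 1 : ℕ) : ℝ) ^ (-(1 / 4 : ℝ)); let χ : Literature.MathematicalPhysics.KineticTheory.T3 → Literature.MathematicalPhysics.KineticTheory.T3 → ℝ := fun x y => if Literature.Analysis.FluidPDE.Torus.euclidDist x y < ℓ then (4 / 3 * Real.pi * ℓ ^ 3)⁻¹ else 0; let ρ : ℝ → Literature.MathematicalPhysics.KineticTheory.T3 → ℝ := fun r x => Literature.MathematicalPhysics.KineticTheory.empiricalDensityField ((Φ N).flow r z) (χ x); let m : ℝ → Literature.MathematicalPhysics.KineticTheory.T3 → Literature.MathematicalPhysics.KineticTheory.V3 := fun r x => Literature.MathematicalPhysics.KineticTheory.empiricalMomentumField ((Φ N).flow r z) (χ x); let e : ℝ → Literature.MathematicalPhysics.KineticTheory.T3 → ℝ := fun r x => Literature.MathematicalPhysics.KineticTheory.empiricalEnergyField ((Φ N).flow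 r z) (χ x); let p : ℝ → Literature.MathematicalPhysics.KineticTheory.T3 → ℝ := fun r x => Literature.MathematicalPhysics.KineticTheory.hsPressure σ (ρ r x) (2 / 3 * (e r x / ρ r x - ‖m r x‖ ^ 2 / (2 * ρ r x ^ 2))); let Mt : ℝ → (Literature.MathematicalPhysics.KineticTheory.T3 → Literature.MathematicalPhysics.KineticTheory.V3) → ℝ := fun r g => ∑ j, (Literature.MathematicalPhysics.KineticTheory.empiricalMomentumField ((Φ N).flow r z) (fun y => g y j)) j; (∀ r ∈ Set.Icc 0 (0 + τ), ∀ i, ‖((Φ N).flow r z i).2‖ ≤ ((N + 1 : ℕ) : ℝ) ^ (1 / 24 : ℝ)) ∧ (∀ r ∈ Set.Icc 0 (0 + τ), ∀ x, ρ r x * σ ^ 3 ≤ η₁) ∧ δ < |Mt (0 + τ) (ψ (0 + τ)) - Mt 0 (ψ 0) - ∫ r in 0..(0 + τ), (Mt r (Literature.Analysis.FunctionSpaces.Torus.timeDerivWithin (Set.Icc 0 (0 + τ)) ψ r) + ∫ x, ((∑ i, ∑ j, (Literature.Analysis.FunctionSpaces.Torus.partialDeriv i (ψ r) x) j * (m r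 x i * m r x j / ρ r x)) + p r x * Literature.Analysis.FunctionSpaces.Torus.divergence (ψ r) x))|}

open Literature.Analysis.FluidPDE Literature.MathematicalPhysics.KineticTheory in
/-- The typed negation: a linear-cost floor for the crux's event refutes the `∀ M` claim.  Pure
bookkeeping (choose `σ < min σ₀ σ₁ ⊓ 1/2`, Alexander's flows, `M := c + 1`); what is NOT
bookkeeping is `NeedleDefectFloor` itself — an L/XL disproof programme (census §Negation N1). -/
theorem not_momentumClosureCost_of_needleDefectFloor (hW : NeedleDefectFloor) :
    ¬ MomentumClosureCost := by
  rintro ⟨η₁, hη₁, σ₀, hσ₀, H⟩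
  obtain ⟨σ₁, hσ₁, W⟩ := hW η₁ hη₁
  have hmin : 0 < min (min σ₀ σ₁) 2⁻¹ := lt_min (lt_min hσ₀ hσ₁) (by norm_num)
  set σ : ℝ := min (min σ₀ σ₁) 2⁻¹ / 2 with hσdef
  have hσ : 0 < σ := by positivity
  have hσlt : σ < min (min σ₀ σ₁) 2⁻¹ := by rw [hσdef]; linarith
  have hσσ₀ : σ < σ₀ := hσlt.trans_le ((min_le_left _ _).trans (min_le_left _ _))
  have hσσ₁ : σ < σ₁ := hσlt.trans_le ((min_le_left _ _).trans (min_le_right _ _))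
  have hσ2 : σ < 2⁻¹ := hσlt.trans_le (min_le_right _ _)
  let Φ : (N : ℕ) → HardSphereFlow (Torus.geometry (Fin 3)) (hsDiameter σ N) (N + 1) := fun N =>
    Classical.choice (HardSphereFlow.nonempty_torus_holds (d := Fin 3) (hsDiameter_pos hσ N)
      ((hsDiameter_le hσ.le N).trans_lt hσ2) (N + 1))
  obtain ⟨θe, hθe, τ, hτ, ψ, hψ, δ, hδ, c, hfreq⟩ := W σ hσ hσσ₁ Φ
  have hev := H σ hσ hσσ₀ θe hθe Φ 0 τ le_rfl hτ ψ hψ δ hδ (c + 1)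
  obtain ⟨N, hlt, hle⟩ := (hfreq.and_eventually hev).exists
  have h := hlt.trans_le hle
  rw [ENNReal.ofReal_lt_ofReal_iff (Real.exp_pos _), Real.exp_lt_exp] at h
  have hN : (0 : ℝ) < (N : ℝ) + 1 := by positivity
  nlinarith [h, hN]

end Summit.AtomisticToContinuum.HydrodynamicLimit.Cruxes.MomentumClosureCost.StrategistR1
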